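import Summits.Ventures.HodgeRepro2.T5SU11GaussLegendreConvergence
import Mathlib.Analysis.Calculus.Taylor

/-!
# The Gauss–Legendre error for smooth functions: the stability bound `|∫ f − Q_n f| ≤ 4 E_{2n−1}(f)` and
`|∫ f − Q_n f| ≤ 4 sup |f^{(2n)}| / (2n)!`

The `n`-point Gauss–Legendre rule `Q_n` (row 419) is exact on the polynomials of degree `≤ 2n − 1` and stable
(`|Q_n g| ≤ 2 sup |g|`), so for EVERY polynomial `p` of degree `≤ 2n − 1` with `|f − p| ≤ M` on `[−1, 1]`

  **`|∫_{−1}^{1} f − Q_n f| ≤ 4M`**   (`abs_integral_sub_gaussRule_le`):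

the quadrature error is at most four times the best uniform approximation error `E_{2n−1}(f)` of `f` by
polynomials of degree `≤ 2n − 1`. Taylor's theorem with the Lagrange remainder (Mathlib's
`taylor_mean_remainder_lagrange_iteratedDeriv`, expansion at `0`, on both sides of `0`) supplies such a `p` for
`f ∈ C^{2n}(ℝ)`: the Taylor polynomial `T_{2n−1}` of `f` at `0` (`taylorPoly`), with `|f − T_{2n−1}| ≤
sup_{[−1,1]} |f^{(2n)}| / (2n)!` on `[−1, 1]` (`abs_sub_taylorPoly_le`). Hence

  **`|∫_{−1}^{1} f − Q_n f| ≤ 4 sup_{[−1,1]} |f^{(2n)}| / (2n)!`**   (`abs_integral_sub_gaussRule_le_of_contDiff`):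

the Gauss–Legendre error of a `C^{2n}` function decays at least like `1/(2n)!` times the size of the `2n`-th
derivative (the classical sharp constant `2^{2n+1}(n!)⁴/((2n+1)((2n)!)³)` of the Hermite-interpolation proof is
not claimed; row 413 has the exact error on polynomials of degree `2n`). Nothing is claimed about (N).

Blind lane: Mathlib + the HodgeRepro2 prefix only; no sorry; axioms ⊆ {propext, Classical.choice,
Quot.sound}.
-/

namespace Summit.Ventures.HodgeRepro2.T5SU11GaussLegendreTaylorError

open Polynomial intervalIntegral Finset Filter Topology MeasureTheory
open Set (Icc Ioo Ioc uIcc uIoo uIoc)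
open T5SU11SphericalLegendreAll T5SU11LegendreIdentities T5SU11GaussLegendreConvergence

/-! ### The stability bound -/

/-- **`|∫ f − Q_n f| ≤ 4M` whenever `|f − p| ≤ M` on `[−1, 1]` for a polynomial `p` of degree `≤ 2n − 1`**
(exactness on `p`, `|∫ (f − p)| ≤ 2M`, stability `|Q_n (f − p)| ≤ 2M`). -/
theorem abs_integral_sub_gaussRule_le {n : ℕ} (hn : 1 ≤ n) {f : ℝ → ℝ} (hf : ContinuousOn f (Icc (-1 : ℝ) 1))
    {p : ℝ[X]} (hp : p.natDegree ≤ 2 * n - 1) {M : ℝ} (hM : ∀ x ∈ Icc (-1 : ℝ) 1, |f x - p.eval x| ≤ M) :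
    |(∫ x in (-1 : ℝ)..1, f x) - gaussRule n f| ≤ 4 * M := by
  have hex := gaussRule_eq_integral hn hp
  have h1 : (∫ x in (-1 : ℝ)..1, f x) - gaussRule n f
      = (∫ x in (-1 : ℝ)..1, (f x - p.eval x)) - gaussRule n (fun x => f x - p.eval x) := by
    rw [gaussRule_sub, hex,
      integral_sub (hf.intervalIntegrable_of_Icc (by norm_num)) (p.continuous.intervalIntegrable _ _)]
    ring
  rw [h1]
  have h2 : |∫ x in (-1 : ℝ)..1, (f x - p.eval x)| ≤ M * |(1 : ℝ) - (-1)| := by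
    have := norm_integral_le_of_norm_le_const (a := (-1 : ℝ)) (b := 1) (C := M)
      (f := fun x => f x - p.eval x) fun x hx => by
        rw [Real.norm_eq_abs]
        refine hM x ?_
        rw [Set.uIoc_of_le (by norm_num)] at hx
        exact Set.Ioc_subset_Icc_self hx
    simpa only [Real.norm_eq_abs] using this
  have h3 : |gaussRule n (fun x => f x - p.eval x)| ≤ 2 * M :=
    abs_gaussRule_le hn fun x hx => hM x (Set.Ioo_subset_Icc_self hx)
  calc |(∫ x in (-1 : ℝ)..1, (f x - p.eval x)) - gaussRule n (fun x => f x - p.eval x)|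
      ≤ |∫ x in (-1 : ℝ)..1, (f x - p.eval x)| + |gaussRule n (fun x => f x - p.eval x)| := abs_sub _ _
    _ ≤ M * |(1 : ℝ) - (-1)| + 2 * M := add_le_add h2 h3
    _ = 4 * M := by norm_num; ring

/-! ### The Taylor polynomial at `0` as a polynomial -/

/-- **The Taylor polynomial of `f` at `0` of degree `m`**, `T_m f = Σ_{k ≤ m} f^{(k)}(0)/k! · X^k`, in `ℝ[X]`. -/
noncomputable def taylorPoly (f : ℝ → ℝ) (m : ℕ) : ℝ[X] :=
  ∑ k ∈ range (m + 1), C (((k.factorial : ℝ))⁻¹ * iteratedDeriv k f 0) * X ^ k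

/-- `natDegree (T_m f) ≤ m`. -/
theorem natDegree_taylorPoly_le (f : ℝ → ℝ) (m : ℕ) : (taylorPoly f m).natDegree ≤ m := by
  refine natDegree_sum_le_of_forall_le _ _ fun k hk => ?_
  calc (C (((k.factorial : ℝ))⁻¹ * iteratedDeriv k f 0) * X ^ k).natDegree ≤ (X ^ k : ℝ[X]).natDegree :=
        natDegree_C_mul_le _ _
    _ ≤ k := natDegree_X_pow_le k
    _ ≤ m := Nat.lt_succ_iff.mp (Finset.mem_range.mp hk)

/-- `T_m f (0) = f(0)`. -/
theorem taylorPoly_eval_zero (f : ℝ → ℝ) (m : ℕ) : (taylorPoly f m).eval 0 = f 0 := by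
  rw [taylorPoly, eval_finsetSum, Finset.sum_eq_single 0]
  · simp
  · intro k _ hk
    simp [hk]
  · intro h
    exact absurd (Finset.mem_range.mpr (Nat.succ_pos m)) h

/-- Mathlib's Taylor polynomial `taylorWithinEval f m (uIcc 0 x) 0 x` is the evaluation of `T_m f` at `x` for
`f ∈ C^m` and `x ≠ 0` (the derivatives within `[[0, x]]` at `0` are the true derivatives). -/
theorem taylorWithinEval_eq_taylorPoly {f : ℝ → ℝ} {m : ℕ} (hf : ContDiff ℝ m f) {x : ℝ} (hx : x ≠ 0) :
    taylorWithinEval f m (uIcc 0 x) 0 x = (taylorPoly f m).eval x := by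
  have hu : UniqueDiffOn ℝ (uIcc 0 x) := by
    rw [Set.uIcc]
    exact uniqueDiffOn_Icc (by rcases lt_or_gt_of_ne hx with h | h <;> simp [h])
  rw [taylor_within_apply, taylorPoly, eval_finsetSum]
  refine Finset.sum_congr rfl fun k hk => ?_
  have hk' : (k : WithTop ℕ∞) ≤ m := by
    exact_mod_cast Nat.lt_succ_iff.mp (Finset.mem_range.mp hk)
  rw [iteratedDerivWithin_eq_iteratedDeriv hu ((hf.of_le hk').contDiffAt) Set.left_mem_uIcc, eval_mul, eval_C,
    eval_pow, eval_X, smul_eq_mul, sub_zero]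
  ring

/-- **Taylor's theorem on `[−1, 1]`**: for `f ∈ C^{m+1}(ℝ)` with `|f^{(m+1)}| ≤ C` on `[−1, 1]`,
`|f(x) − T_m f(x)| ≤ C |x|^{m+1}/(m + 1)! ≤ C/(m + 1)!` for every `x ∈ [−1, 1]`. -/
theorem abs_sub_taylorPoly_le {f : ℝ → ℝ} {m : ℕ} (hf : ContDiff ℝ (m + 1) f) {C : ℝ}
    (hC : ∀ x ∈ Icc (-1 : ℝ) 1, |iteratedDeriv (m + 1) f x| ≤ C) {x : ℝ} (hx : x ∈ Icc (-1 : ℝ) 1) :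
    |f x - (taylorPoly f m).eval x| ≤ C / (m + 1).factorial := by
  have hC0 : 0 ≤ C := (abs_nonneg _).trans (hC 0 (by norm_num))
  rcases eq_or_ne x 0 with rfl | hx0
  · rw [taylorPoly_eval_zero, sub_self, abs_zero]
    positivity
  · have hcd : ContDiffOn ℝ (m + 1) f (uIcc 0 x) := hf.contDiffOn
    obtain ⟨x', hx', heq⟩ := taylor_mean_remainder_lagrange_iteratedDeriv hx0.symm hcd
    have hm : ContDiff ℝ m f := hf.of_le (by exact_mod_cast Nat.le_succ m)
    rw [← taylorWithinEval_eq_taylorPoly hm hx0, heq]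
    have hx'mem : x' ∈ Icc (-1 : ℝ) 1 :=
      Set.Ioo_subset_Icc_self (Set.uIoo_subset_Ioo (by norm_num) hx hx')
    have hxabs : |x| ≤ 1 := abs_le.mpr ⟨hx.1, hx.2⟩
    rw [abs_div, abs_mul, abs_pow, sub_zero, Nat.abs_cast]
    have hfac : (0 : ℝ) < (m + 1).factorial := by positivity
    rw [div_le_div_iff_of_pos_right hfac]
    calc |iteratedDeriv (m + 1) f x'| * |x| ^ (m + 1) ≤ C * 1 := by
          refine mul_le_mul (hC x' hx'mem) (pow_le_one₀ (abs_nonneg _) hxabs) (by positivity) hC0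
      _ = C := mul_one C

/-! ### The Gauss–Legendre error for `C^{2n}` functions -/

/-- **The Gauss–Legendre error for `C^{2n}` functions**: `|∫_{−1}^{1} f − Q_n f| ≤ 4 C/(2n)!` whenever
`|f^{(2n)}| ≤ C` on `[−1, 1]` (`n ≥ 1`). -/
theorem abs_integral_sub_gaussRule_le_of_contDiff {n : ℕ} (hn : 1 ≤ n) {f : ℝ → ℝ}
    (hf : ContDiff ℝ ((2 * n : ℕ) : WithTop ℕ∞) f) {C : ℝ}
    (hC : ∀ x ∈ Icc (-1 : ℝ) 1, |iteratedDeriv (2 * n) f x| ≤ C) :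
    |(∫ x in (-1 : ℝ)..1, f x) - gaussRule n f| ≤ 4 * (C / (2 * n).factorial) := by
  obtain ⟨m, hm⟩ : ∃ m, 2 * n = m + 1 := ⟨2 * n - 1, by omega⟩
  rw [hm] at hf hC ⊢
  refine abs_integral_sub_gaussRule_le hn hf.continuous.continuousOn (p := taylorPoly f m)
    ((natDegree_taylorPoly_le f m).trans (by omega)) fun x hx => ?_
  exact abs_sub_taylorPoly_le hf hC hx

/-- The same bound with the sup norm of `f^{(2n)}` over `[−1, 1]` replaced by a bound on all of `ℝ`. -/
theorem abs_integral_sub_gaussRule_le_of_contDiff' {n : ℕ} (hn : 1 ≤ n) {f : ℝ → ℝ}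
    (hf : ContDiff ℝ ((2 * n : ℕ) : WithTop ℕ∞) f) {C : ℝ} (hC : ∀ x, |iteratedDeriv (2 * n) f x| ≤ C) :
    |(∫ x in (-1 : ℝ)..1, f x) - gaussRule n f| ≤ 4 * (C / (2 * n).factorial) :=
  abs_integral_sub_gaussRule_le_of_contDiff hn hf fun x _ => hC x

/-- **Super-exponential convergence for functions with uniformly bounded derivatives**: if
`|f^{(k)}| ≤ C` on `[−1, 1]` for every `k` and `f ∈ C^∞`, then `|∫ f − Q_n f| ≤ 4C/(2n)!` for every `n ≥ 1`. -/
theorem abs_integral_sub_gaussRule_le_of_contDiff_top {f : ℝ → ℝ} (hf : ContDiff ℝ (⊤ : ℕ∞) f) {C : ℝ}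
    (hC : ∀ k, ∀ x ∈ Icc (-1 : ℝ) 1, |iteratedDeriv k f x| ≤ C) {n : ℕ} (hn : 1 ≤ n) :
    |(∫ x in (-1 : ℝ)..1, f x) - gaussRule n f| ≤ 4 * (C / (2 * n).factorial) :=
  abs_integral_sub_gaussRule_le_of_contDiff hn (hf.of_le (WithTop.coe_le_coe.mpr le_top)) (hC (2 * n))

end Summit.Ventures.HodgeRepro2.T5SU11GaussLegendreTaylorError
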